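import Summits.FinalStateConjecture.FinalStateConjecture.Theorems.EIHFluxBalanceModulatedKerrHandoffTameExistsForm
import Summits.FinalStateConjecture.FinalStateConjecture.Theorems.EIHFluxBalanceModulatedKerrHandoffCoreDefs
import HarnessLib

/-!
# `EIHFluxBalance.ModulatedKerrHandoff` (item stmt-FinalStateConjecture-17402, H′), line `trim-on-the-cure`:
# piece U (`FarTrimUpgrade`) CONTAINS the pointwise far-trim upgrade of core-good data

Stub worker of `stub_farTrimUpgrade` (lead `prover-line-stmt-FinalStateConjecture-17402-c3-0`), 2026-08-17.

Piece U of the cut `H′ ⇐ T ∧ C ∧ U` (vocabulary `Theorems/EIHFluxBalanceModulatedKerrHandoffTrimDefs.lean`,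
`…CoreDefs.lean`; the kick / trimming vocabulary is quoted inlined here, as in the registered stub) says: for a local kick family `G`
through an admissible `d` whose members with `0 < c₀ < δ` have the CORE handoff property, and a tame
trimming family `T` of `d` on its sole end `e`, there is a threshold `ρ₁`, bounded on compact
subintervals of `(0, δ)`, beyond which every admissible "`G c` inside `e.far R`, `T R` outside" datum
has a maximal vacuum Cauchy development with the FULL `HandoffClause`.

This file records, sorry-free, the degenerate instance the line's card asks to be tested first
(`Cruxes/ModulatedKerrHandoff/Lines/trim-on-the-cure.md`, stub U): at a CORE-GOOD base datum the
constant family `G c = d` is a local kick family (`isLocalKick_const`, empty compact set), the patched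
datum with the sections of `d` off `e.far R` and of `T R` on `e.far R` may be taken to be `T R` itself
(`T R = d` off `e.far R` is a clause of `IsTameTrimmingFamily`), and ONE maximal development with the
clause is the full per-datum property (`handoffPropT_iff_exists`: MGHD uniqueness `mghd_unique_cauchy`
plus transport of the seventeen clauses). Hence

* `trimUpgrade_of_farTrimUpgrade` — **U ⟹ U₀**: every tame trimming `T R`, `R ≥ max R₀ R₁`, of a
  core-good admissible datum has the handoff property `HandoffPropT` of the crux (is NOT exceptional).

`U₀` is genericity-free AND family-free: it is the pointwise statement a refuter of U must break
(a core-good, hyperbolically receding, sub-extremal-with-margin datum and radii `Rₙ → ∞` with `T Rₙ`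
exceptional), and the statement far-surgery stability addresses (Klainerman–Szeftel 2023 §3.4 /
Giorgi–Klainerman–Szeftel 2022 for one slowly rotating hole; nothing in print for `N ≥ 2` — route item
stmt-FinalStateConjecture-10183 `RecedingBasinStability`). U itself adds to `U₀` only the replacement of
`d` by the core-good members `G c` and the LOCAL BOUNDEDNESS of the threshold in `c₀` (needed by the
smooth receding schedule of `exists_tameCurve_of_kick_trim`); no converse `U₀ ⟹ U` is claimed.
-/

noncomputable section

namespace Summit.FinalStateConjecture.FinalStateConjecture.Theorems.EIHFluxBalance.TameTemplate

open scoped Topology Manifold ContDiff ENNReal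
open Filter Set Function TopologicalSpace Literature.Geometry.Lorentzian InitialDataSet

-- D-0017: single-problem summit, `Summit.<S>.<S>.…` by design.
set_option linter.dupNamespace false

/-- **U ⟹ U₀: piece U of line `trim-on-the-cure` contains the pointwise far-trim upgrade of core-good
data.** If `FarTrimUpgrade` holds (hypothesis `hU`: the registered stub `stub_farTrimUpgrade` with the
core property and the handoff clause named, `CoreHandoffProp` / `HandoffClause`, definitionally its
text), then for every admissible datum `d` with the CORE handoff property on its sole
Dafermos–Rodnianski end `e` and every tame trimming family `T` of `d` on `e` beyond `R₀`, there is a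
radius `R₁` such that every `T R` with `R ≥ max R₀ R₁` has the FULL handoff property `HandoffPropT`
(an MGHD exists and every MGHD has complete `𝓘⁺` and the modulated multi-Kerr–Schild ansatz with
(T), (O), (R), (QS)). Proof: the constant family is a local kick family (`isLocalKick_const`), the
patched datum is `T R` itself, and one maximal development with the clause suffices
(`handoffPropT_iff_exists`). The dynamical content (far-surgery stability of an already-handing-off
development) is Klainerman–Szeftel's exterior-layer smallness for one slowly rotating hole.
[cite: KlainermanSzeftel2023, Main Theorem §3.4.3 (3.4.7)–(3.4.8)] [cite: DafermosLuk2017, Conjecture 1] -/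
theorem trimUpgrade_of_farTrimUpgrade :
    ∀ (hU : ∀ (X : Type) [TopologicalSpace X] [ChartedSpace E3 X] [IsManifold (𝓡 3) ((⊤ : ℕ∞) : WithTop ℕ∞) X] [T2Space X] [SecondCountableTopology X] [ConnectedSpace X], ∀ d ∈ admissibleVacuumData X, ∀ (G : EuclideanSpace ℝ (Fin 1) → InitialDataSet (𝓡 3) X) (δ : ℝ), (InitialDataSet.IsSmoothDataFamily 1 G ∧ G 0 = d ∧ (∀ c, G c ∈ admissibleVacuumData X) ∧ ∃ K : Set X, IsCompact K ∧ ∀ c, ∀ x ∉ K, (G c).h.inner x = d.h.inner x ∧ (G c).k x = d.k x) → 0 < δ → (∀ c : EuclideanSpace ℝ (Fin 1), 0 < c 0 → c 0 < δ → CoreHandoffProp X (G c)) → ∀ (e : AFEnd X) (M₀ R₀ : ℝ) (T : ℝ → InitialDataSet (𝓡 3) X) (M : ℝ → ℝ), e.IsSoleEnd → e.IsStronglyAsymptoticallyFlatDR d M₀ → ((∀ R, R₀ ≤ R → T R ∈ admissibleVacuumData X ∧ (∃ Mt : ℝ, e.IsStronglyAsymptoticallyFlatWith (T R) Mt (15 /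 8) (23 / 8) 4 3) ∧ e.IsStronglyAsymptoticallyFlatDR (T R) (M R) ∧ ∀ x ∉ e.far R, (T R).h.inner x = d.h.inner x ∧ (T R).k x = d.k x) ∧ (∀ ρ : EuclideanSpace ℝ (Fin 1) → ℝ, ContDiff ℝ ((⊤ : ℕ∞) : WithTop ℕ∞) ρ → (∀ c, R₀ ≤ ρ c) → InitialDataSet.IsSmoothDataFamily 1 (fun c ↦ T (ρ c))) ∧ ContinuousOn M (Set.Ici R₀) ∧ Tendsto M atTop (𝓝 M₀) ∧ Tendsto (fun R ↦ e.wDist (T R) d) atTop (𝓝 0)) → ∃ ρ₁ : ℝ → ℝ, (∀ a b : ℝ, 0 < a → a ≤ b → b < δ → BddAbove (ρ₁ '' Set.Icc a b)) ∧ ∀ c : EuclideanSpace ℝ (Fin 1), 0 < c 0 → c 0 < δ → ∀ R : ℝ, R₀ ≤ R → ρ₁ (c 0) ≤ R → ∀ D' ∈ admissibleVacuumData X, (∀ x ∉ e.far R, D'.h.inner x = (G c).h.inner x ∧ D'.k x = (G c).k x) → (∀ x ∈ e.far R, D'.h.inner x = (T R).h.inner x ∧ D'.k x = (T R).k x) →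 ∃ 𝒟 : VacuumCauchyDevelopment D', 𝒟.IsMaximal ∧ HandoffClause X D' 𝒟), ∀ (X : Type) [TopologicalSpace X] [ChartedSpace E3 X] [IsManifold (𝓡 3) ((⊤ : ℕ∞) : WithTop ℕ∞) X] [T2Space X] [SecondCountableTopology X] [ConnectedSpace X], ∀ d ∈ admissibleVacuumData X, CoreHandoffProp X d → ∀ (e : AFEnd X) (M₀ R₀ : ℝ) (T : ℝ → InitialDataSet (𝓡 3) X) (M : ℝ → ℝ), e.IsSoleEnd → e.IsStronglyAsymptoticallyFlatDR d M₀ → ((∀ R, R₀ ≤ R → T R ∈ admissibleVacuumData X ∧ (∃ Mt : ℝ, e.IsStronglyAsymptoticallyFlatWith (T R) Mt (15 / 8) (23 / 8) 4 3) ∧ e.IsStronglyAsymptoticallyFlatDR (T R) (M R) ∧ ∀ x ∉ e.far R, (T R).h.inner x = d.h.inner x ∧ (T R).k x = d.k x) ∧ (∀ ρ : EuclideanSpace ℝ (Fin 1) → ℝ, ContDiff ℝ ((⊤ : ℕ∞) : WithTop ℕ∞) ρ → (∀ c, R₀ ≤ ρ c) → InitialDataSet.IsSmoothDataFamily 1 (fun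 c ↦ T (ρ c))) ∧ ContinuousOn M (Set.Ici R₀) ∧ Tendsto M atTop (𝓝 M₀) ∧ Tendsto (fun R ↦ e.wDist (T R) d) atTop (𝓝 0)) → ∃ R₁ : ℝ, ∀ R : ℝ, R₀ ≤ R → R₁ ≤ R → HandoffPropT X (T R) := by
  intro hU X _ _ _ _ _ _ d hd hcore e M₀ R₀ T M hsole hDR hT
  obtain ⟨ρ₁, -, hgood⟩ :=
    hU X d hd (fun _ ↦ d) 1 ⟨isSmoothDataFamily_const 1 d, rfl, fun _ ↦ hd, ∅, isCompact_empty, fun _ _ _ ↦ ⟨rfl, rfl⟩⟩ one_pos (fun _ _ _ ↦ hcore) e M₀ R₀ T M hsole hDR hT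
  refine ⟨ρ₁ 2⁻¹, fun R hR₀ hR₁ ↦ ?_⟩
  have h2 : (EuclideanSpace.single (0 : Fin 1) (2⁻¹ : ℝ)) 0 = 2⁻¹ := by simp
  obtain ⟨𝒟, hmax, hcl⟩ := hgood (EuclideanSpace.single 0 2⁻¹) (by rw [h2]; positivity)
    (by rw [h2]; norm_num) R hR₀ (by rwa [h2]) (T R) (hT.1 R hR₀).1
    (fun x hx ↦ (hT.1 R hR₀).2.2.2 x hx) (fun _ _ ↦ ⟨rfl, rfl⟩)
  exact (handoffPropT_iff_exists X (T R)).2 ⟨𝒟, hmax, hcl⟩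

end Summit.FinalStateConjecture.FinalStateConjecture.Theorems.EIHFluxBalance.TameTemplate

end
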